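import Mathlib

/-!
# Polynomial approximation of the sign function with the optimal rate

Stub `stub_signPolyApprox` for the line `weyl-window` of
`Summit.QuantumFields.QCD.Theses.SpectralDefectExtinction.ExtinctionBuildsQCD`.

For `t ∈ (0,1]` and a degree budget `D` we build a real polynomial `p` of degree `≤ D`
with `|p - 1| ≤ (C₀/t) e^{-c₀ D t}` on `[t, 9]` and `|p + 1| ≤ (C₀/t) e^{-c₀ D t}` on `[-9, -t]`
(`c₀ = 1/16`, `C₀ = 300`).
Construction (Chebyshev needle): `K = (T_n ∘ φ_t)²` with the quadratic
`φ_t(s) = (81 + t² - 2 s²)/(81 - t²)`, `Q` a formal antiderivative of `K`, and `p` the affine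
renormalisation of `Q` with `p(9) = 1`, `p(-9) = -1`.
-/

noncomputable section

open Polynomial Real

namespace Summit.QuantumFields.QCD.Cruxes.ExtinctionBuildsQCD.WeylWindow

/-! ### Polynomial calculus -/

/-- Every real polynomial has a formal antiderivative of degree at most one more. -/
private lemma exists_antider (K : ℝ[X]) :
    ∃ Q : ℝ[X], derivative Q = K ∧ Q.natDegree ≤ K.natDegree + 1 := by
  refine ⟨∑ i ∈ K.support, C (K.coeff i / (i + 1)) * X ^ (i + 1), ?_, ?_⟩
  · rw [derivative_sum]
    conv_rhs => rw [K.as_sum_support_C_mul_X_pow]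
    refine Finset.sum_congr rfl fun i _ => ?_
    rw [derivative_C_mul_X_pow, Nat.add_sub_cancel, Nat.cast_succ,
      div_mul_cancel₀ _ (by positivity)]
  · refine natDegree_sum_le_of_forall_le _ _ fun i hi => ?_
    refine (natDegree_C_mul_X_pow_le _ _).trans ?_
    have := le_natDegree_of_mem_supp i hi
    omega

/-- Mean value lower bound for a polynomial from a lower bound on its derivative. -/
private lemma mul_sub_le_eval_sub (Q : ℝ[X]) {a b m : ℝ} (hab : a ≤ b)
    (h : ∀ s, a ≤ s → s ≤ b → m ≤ Q.derivative.eval s) :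
    m * (b - a) ≤ Q.eval b - Q.eval a := by
  refine (convex_Icc a b).mul_sub_le_image_sub_of_le_deriv (f := fun x => Q.eval x)
    Q.continuousOn Q.differentiableOn (C := m) ?_ a (Set.left_mem_Icc.2 hab) b
    (Set.right_mem_Icc.2 hab) hab
  intro x hx
  rw [Polynomial.deriv]
  exact h x (interior_subset hx).1 (interior_subset hx).2

/-- Mean value upper bound for a polynomial from an upper bound on its derivative. -/
private lemma eval_sub_le_mul_sub (Q : ℝ[X]) {a b M : ℝ} (hab : a ≤ b)
    (h : ∀ s, a ≤ s → s ≤ b → Q.derivative.eval s ≤ M) :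
    Q.eval b - Q.eval a ≤ M * (b - a) := by
  refine (convex_Icc a b).image_sub_le_mul_sub_of_deriv_le (f := fun x => Q.eval x)
    Q.continuousOn Q.differentiableOn (C := M) ?_ a (Set.left_mem_Icc.2 hab) b
    (Set.right_mem_Icc.2 hab) hab
  intro x hx
  rw [Polynomial.deriv]
  exact h x (interior_subset hx).1 (interior_subset hx).2

/-! ### Growth of Chebyshev polynomials to the right of `1` -/

/-- If `cosh θ ≤ y` with `θ ≥ 0` then `exp (n θ) / 2 ≤ T_n(y)`. -/
private lemma exp_le_eval_T {θ y : ℝ} (hθ : 0 ≤ θ) (hy : Real.cosh θ ≤ y) (n : ℕ) :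
    Real.exp (n * θ) / 2 ≤ (Chebyshev.T ℝ n).eval y := by
  have h1 : 1 ≤ y := (Real.one_le_cosh θ).trans hy
  rw [← Real.cosh_arcosh h1] at hy ⊢
  rw [Chebyshev.T_real_cosh]
  have hθ' : θ ≤ arcosh y := by
    have := Real.cosh_le_cosh.1 hy
    rwa [abs_of_nonneg hθ, abs_of_nonneg (arcosh_nonneg h1)] at this
  have hn : (n : ℝ) * θ ≤ n * arcosh y := mul_le_mul_of_nonneg_left hθ' (Nat.cast_nonneg n)
  have h0 : 0 ≤ (n : ℝ) * θ := by positivity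
  calc Real.exp (n * θ) / 2 ≤ Real.cosh (n * θ) := by
        rw [Real.cosh_eq]
        linarith [Real.exp_nonneg (-(n * θ))]
    _ ≤ Real.cosh (n * arcosh y) := by
        rw [Real.cosh_le_cosh, abs_of_nonneg h0, abs_of_nonneg (h0.trans hn)]
        exact hn
    _ = Real.cosh (((n : ℤ) : ℝ) * arcosh y) := by norm_cast

/-- `cosh (t/8) ≤ 1 + t²/54` for `0 < t ≤ 1`. -/
private lemma cosh_eighth_le {t : ℝ} (ht0 : 0 < t) (ht1 : t ≤ 1) :
    Real.cosh (t / 8) ≤ 1 + t ^ 2 / 54 := by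
  have h1 : Real.cosh (t / 8) ≤ Real.exp ((t / 8) ^ 2 / 2) := Real.cosh_le_exp_half_sq _
  have hsmall : |(t / 8) ^ 2 / 2| ≤ 1 := by
    rw [abs_of_nonneg (by positivity)]
    nlinarith
  have h2 := Real.abs_exp_sub_one_le hsmall
  rw [abs_of_nonneg (by positivity : (0:ℝ) ≤ (t / 8) ^ 2 / 2)] at h2
  have h3 := (le_abs_self _).trans h2
  nlinarith

/-! ### The needle kernel -/

/-- The inner quadratic `φ_t(s) = (81 + t² - 2 s²)/(81 - t²)` maps `t² ≤ s² ≤ 81`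
into `[-1, 1]`. -/
private lemma abs_phi_le_one {t s : ℝ} (ht0 : 0 < t) (ht1 : t ≤ 1) (h1 : t ^ 2 ≤ s ^ 2)
    (h2 : s ^ 2 ≤ 81) : |(81 + t ^ 2 - 2 * s ^ 2) / (81 - t ^ 2)| ≤ 1 := by
  have hw : 0 < 81 - t ^ 2 := by nlinarith
  rw [abs_le]
  constructor
  · rw [le_div_iff₀ hw]; nlinarith
  · rw [div_le_one hw]; nlinarith

/-- The inner quadratic `φ_t` is at least `cosh (t/8)` on `s² ≤ t²/4`. -/
private lemma cosh_le_phi {t s : ℝ} (ht0 : 0 < t) (ht1 : t ≤ 1) (hs : s ^ 2 ≤ t ^ 2 / 4) :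
    Real.cosh (t / 8) ≤ (81 + t ^ 2 - 2 * s ^ 2) / (81 - t ^ 2) := by
  have hw : 0 < 81 - t ^ 2 := by nlinarith
  refine (cosh_eighth_le ht0 ht1).trans ?_
  rw [le_div_iff₀ hw]
  nlinarith

/-- The needle kernel `K = (T_n ∘ φ_t)²`: degree `≤ 4n`, nonnegative, at most `1` on
`t² ≤ s² ≤ 81`, and exponentially large on `s² ≤ t²/4`. -/
private lemma exists_kernel {t : ℝ} (ht0 : 0 < t) (ht1 : t ≤ 1) (n : ℕ) :
    ∃ K : ℝ[X], K.natDegree ≤ 4 * n ∧ (∀ s, 0 ≤ K.eval s) ∧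
      (∀ s, t ^ 2 ≤ s ^ 2 → s ^ 2 ≤ 81 → K.eval s ≤ 1) ∧
      (∀ s, s ^ 2 ≤ t ^ 2 / 4 → Real.exp (n * t / 4) / 4 ≤ K.eval s) := by
  obtain ⟨L, hLev, hLdeg⟩ : ∃ L : ℝ[X],
      (∀ s, L.eval s = (81 + t ^ 2 - 2 * s ^ 2) / (81 - t ^ 2)) ∧ L.natDegree ≤ 2 :=
    ⟨C ((81 + t ^ 2) / (81 - t ^ 2)) - C (2 / (81 - t ^ 2)) * X ^ 2,
      fun s => by simp only [eval_sub, eval_mul, eval_C, eval_pow, eval_X]; ring,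
      (natDegree_sub_le _ _).trans (max_le (by simp) (natDegree_C_mul_X_pow_le _ _))⟩
  have hev : ∀ s, (((Chebyshev.T ℝ n).comp L) ^ 2).eval s =
      ((Chebyshev.T ℝ n).eval ((81 + t ^ 2 - 2 * s ^ 2) / (81 - t ^ 2))) ^ 2 := fun s => by
    simp only [eval_pow, eval_comp, hLev]
  refine ⟨((Chebyshev.T ℝ n).comp L) ^ 2, ?_, fun s => ?_, fun s h1 h2 => ?_, fun s hs => ?_⟩
  · have hN : ((Chebyshev.T ℝ n).comp L).natDegree ≤ 2 * n := by
      refine natDegree_comp_le.trans ?_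
      rw [Chebyshev.natDegree_T, Int.natAbs_natCast]
      calc n * L.natDegree ≤ n * 2 := Nat.mul_le_mul_left _ hLdeg
        _ = 2 * n := mul_comm _ _
    exact natDegree_pow_le.trans (by omega)
  · rw [hev]; positivity
  · rw [hev, sq_le_one_iff_abs_le_one]
    exact Chebyshev.abs_eval_T_real_le_one n (abs_phi_le_one ht0 ht1 h1 h2)
  · have hT := exp_le_eval_T (by positivity : (0:ℝ) ≤ t / 8) (cosh_le_phi ht0 ht1 hs) n
    have h0 : 0 ≤ Real.exp (n * (t / 8)) / 2 := by positivity
    rw [hev]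
    calc Real.exp (n * t / 4) / 4 = (Real.exp (n * (t / 8)) / 2) ^ 2 := by
          rw [div_pow, sq (Real.exp _), ← Real.exp_add]
          congr 1
          · congr 1; ring
          · norm_num
      _ ≤ _ := pow_le_pow_left₀ h0 hT 2

/-! ### The antiderivative of the kernel and the needle polynomial -/

/-- The antiderivative `Q` of the kernel: degree `≤ 4n+1`, monotone, total increase over
`[-9, 9]` at least `t e^{nt/4}/8`, but increase at most `9` over `[x, 9]` for `x ≥ t` and over
`[-9, x]` for `x ≤ -t`. -/
private lemma exists_prim {t : ℝ} (ht0 : 0 < t) (ht1 : t ≤ 1) (n : ℕ) :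
    ∃ Q : ℝ[X], Q.natDegree ≤ 4 * n + 1 ∧ (∀ a b : ℝ, a ≤ b → Q.eval a ≤ Q.eval b) ∧
      t * Real.exp (n * t / 4) / 8 ≤ Q.eval 9 - Q.eval (-9) ∧
      (∀ x, t ≤ x → x ≤ 9 → Q.eval 9 - Q.eval x ≤ 9) ∧
      (∀ x, -9 ≤ x → x ≤ -t → Q.eval x - Q.eval (-9) ≤ 9) := by
  obtain ⟨K, hKdeg, hK0, hK1, hK2⟩ := exists_kernel ht0 ht1 n
  obtain ⟨Q, hQK, hQdeg⟩ := exists_antider K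
  have hmono : ∀ a b : ℝ, a ≤ b → Q.eval a ≤ Q.eval b := fun a b hab => by
    refine monotone_of_deriv_nonneg Q.differentiable (fun x => ?_) hab
    rw [Polynomial.deriv, hQK]
    exact hK0 x
  refine ⟨Q, hQdeg.trans (by omega), hmono, ?_, fun x hx1 hx2 => ?_, fun x hx1 hx2 => ?_⟩
  · have h := mul_sub_le_eval_sub Q (a := 0) (b := t / 2) (m := Real.exp (n * t / 4) / 4)
      (by positivity) (fun s hs1 hs2 => by rw [hQK]; exact hK2 s (by nlinarith))
    have h1 := hmono _ _ (show t / 2 ≤ 9 by linarith)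
    have h2 := hmono _ _ (show (-9 : ℝ) ≤ 0 by norm_num)
    linarith
  · have h := eval_sub_le_mul_sub Q (M := 1) hx2 (fun s hs1 hs2 => by
      rw [hQK]; exact hK1 s (by nlinarith) (by nlinarith))
    linarith
  · have h := eval_sub_le_mul_sub Q (M := 1) hx1 (fun s hs1 hs2 => by
      rw [hQK]; exact hK1 s (by nlinarith) (by nlinarith))
    linarith

/-- Converting the gap lower bound into the final error bound. -/
private lemma abs_div_le {t Δ y : ℝ} (ht0 : 0 < t) (n : ℕ)
    (hgap : t * Real.exp (n * t / 4) / 8 ≤ Δ) (hy0 : 0 ≤ y) (hy9 : y ≤ 9) :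
    |2 * y / Δ| ≤ 144 / t * Real.exp (-(n * t / 4)) := by
  have he : 0 < Real.exp (n * t / 4) := Real.exp_pos _
  have hΔ : 0 < Δ := lt_of_lt_of_le (by positivity) hgap
  rw [abs_of_nonneg (by positivity), Real.exp_neg, ← div_eq_mul_inv, div_div,
    div_le_div_iff₀ hΔ (by positivity)]
  nlinarith [mul_le_mul_of_nonneg_right hgap (by positivity : (0:ℝ) ≤ 2 * y),
    mul_le_mul_of_nonneg_left hy9 (by positivity : (0:ℝ) ≤ t * Real.exp (n * t / 4))]

/-- The needle polynomial at Chebyshev order `n`: degree `≤ 4n+1`, within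
`(144/t) e^{-nt/4}` of `1` on `[t, 9]` and of `-1` on `[-9, -t]`. -/
private lemma exists_needle {t : ℝ} (ht0 : 0 < t) (ht1 : t ≤ 1) (n : ℕ) :
    ∃ p : ℝ[X], p.natDegree ≤ 4 * n + 1 ∧
      (∀ x, t ≤ x → x ≤ 9 → |p.eval x - 1| ≤ 144 / t * Real.exp (-(n * t / 4))) ∧
      (∀ x, -9 ≤ x → x ≤ -t → |p.eval x + 1| ≤ 144 / t * Real.exp (-(n * t / 4))) := by
  obtain ⟨Q, hQdeg, hmono, hgap, hright, hleft⟩ := exists_prim ht0 ht1 n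
  have hΔ : 0 < Q.eval 9 - Q.eval (-9) := lt_of_lt_of_le (by positivity) hgap
  refine ⟨C (2 / (Q.eval 9 - Q.eval (-9))) * Q -
      C ((Q.eval 9 + Q.eval (-9)) / (Q.eval 9 - Q.eval (-9))), ?_,
    fun x hx1 hx2 => ?_, fun x hx1 hx2 => ?_⟩
  · rw [natDegree_sub_C]
    exact (natDegree_C_mul_le _ _).trans hQdeg
  · have : (C (2 / (Q.eval 9 - Q.eval (-9))) * Q -
        C ((Q.eval 9 + Q.eval (-9)) / (Q.eval 9 - Q.eval (-9)))).eval x - 1 =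
        -(2 * (Q.eval 9 - Q.eval x) / (Q.eval 9 - Q.eval (-9))) := by
      simp only [eval_sub, eval_mul, eval_C]
      field_simp
      ring
    rw [this, abs_neg]
    exact abs_div_le ht0 n hgap (sub_nonneg.2 (hmono _ _ hx2)) (hright x hx1 hx2)
  · have : (C (2 / (Q.eval 9 - Q.eval (-9))) * Q -
        C ((Q.eval 9 + Q.eval (-9)) / (Q.eval 9 - Q.eval (-9)))).eval x + 1 =
        2 * (Q.eval x - Q.eval (-9)) / (Q.eval 9 - Q.eval (-9)) := by
      simp only [eval_sub, eval_mul, eval_C]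
      field_simp
      ring
    rw [this]
    exact abs_div_le ht0 n hgap (sub_nonneg.2 (hmono _ _ hx1)) (hleft x hx1 hx2)

/-! ### Main statement -/

/-- **Sign approximation with the optimal rate.** There are absolute constants `c₀, C₀ > 0`
such that for every `t ∈ (0, 1]` and every degree budget `D` some real polynomial of degree
`≤ D` is within `(C₀/t)·exp(-c₀ D t)` of `+1` on `[t, 9]` and of `-1` on `[-9, -t]`. -/
theorem stub_signPolyApprox : ∃ c₀ C₀ : ℝ, 0 < c₀ ∧ 0 < C₀ ∧ ∀ t : ℝ, 0 < t → t ≤ 1 → ∀ D : ℕ, ∃ p : Polynomial ℝ, p.natDegree ≤ D ∧ (∀ x : ℝ, t ≤ x → x ≤ 9 → |p.eval x - 1| ≤ C₀ / t * Real.exp (-(c₀ * D * t))) ∧ (∀ x : ℝ, -9 ≤ x → x ≤ -t → |p.eval x + 1| ≤ C₀ / t * Real.exp (-(c₀ * D * t))) := by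
  refine ⟨1 / 16, 300, by norm_num, by norm_num, ?_⟩
  intro t ht0 ht1 D
  rcases Nat.eq_zero_or_pos D with hD | hD
  · subst hD
    have h1 : (1 : ℝ) ≤ 300 / t * Real.exp (-(1 / 16 * ((0 : ℕ) : ℝ) * t)) := by
      rw [Nat.cast_zero, mul_zero, zero_mul, neg_zero, Real.exp_zero, mul_one,
        le_div_iff₀ ht0]
      linarith
    refine ⟨0, by simp, fun x _ _ => ?_, fun x _ _ => ?_⟩
    · simpa using h1
    · simpa using h1
  · set m : ℕ := (D - 1) / 4 with hm
    have hmD : D ≤ 4 * m + 4 := by omega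
    have hmR : (D : ℝ) ≤ 4 * (m : ℝ) + 4 := by exact_mod_cast hmD
    have he : Real.exp (-(m * t / 4)) ≤ Real.exp (1 / 4) * Real.exp (-(1 / 16 * D * t)) := by
      rw [← Real.exp_add, Real.exp_le_exp]
      nlinarith [mul_le_mul_of_nonneg_right hmR ht0.le]
    have h14 : Real.exp (1 / 4) ≤ 3 / 2 := by
      have h := Real.abs_exp_sub_one_le (x := 1 / 4) (by rw [abs_le]; constructor <;> norm_num)
      have h' := (le_abs_self _).trans h
      rw [abs_of_nonneg (by norm_num : (0:ℝ) ≤ 1 / 4)] at h'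
      linarith
    have hE0 : 0 ≤ Real.exp (-(1 / 16 * D * t)) := (Real.exp_pos _).le
    have key : 144 / t * Real.exp (-(m * t / 4)) ≤ 300 / t * Real.exp (-(1 / 16 * D * t)) := by
      calc 144 / t * Real.exp (-(m * t / 4))
          ≤ 144 / t * (3 / 2 * Real.exp (-(1 / 16 * D * t))) := by
            gcongr
            exact he.trans (by gcongr)
        _ = (216 * Real.exp (-(1 / 16 * D * t))) / t := by ring
        _ ≤ (300 * Real.exp (-(1 / 16 * D * t))) / t :=
            div_le_div_of_nonneg_right (by nlinarith [hE0]) ht0.le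
        _ = 300 / t * Real.exp (-(1 / 16 * D * t)) := by ring
    obtain ⟨p, hdeg, h1, h2⟩ := exists_needle ht0 ht1 m
    exact ⟨p, hdeg.trans (by omega), fun x hx1 hx2 => (h1 x hx1 hx2).trans key,
      fun x hx1 hx2 => (h2 x hx1 hx2).trans key⟩

end Summit.QuantumFields.QCD.Cruxes.ExtinctionBuildsQCD.WeylWindow

end
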